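import Mathlib
import HarnessLib
import Summits.HubbardSuperconductivity.HubbardSuperconductivity.Theorems.KLProgrammeKLRegimeVolumeLimitDoorsV14

/-!
# Route `KLProgramme` — VL child (stmt-HubbardSuperconductivity-19858 `klPredsV12` / its gen-5 re-base `klPredsV14`), Cauchy stub
# `stub_vl_twoVolumeRate`: the doors IN REGIME FORM — the bare-frame inputs are asked only where the stub asks them
# (cell gate-hubbard-kl, seat hubbard-kl-k3c4-p1 g4; sequel of `…VolumeLimitRateDoor` / `…VolumeLimitDoorsV14`)

The doors `stub_vl_twoVolumeRate_of_bareFrameRate[_V14]` and `stub_vl_twoVolumeRate_of_bareSplit[_V14]` take their bare-frame inputs for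
EVERY `β > 0`, `U`, `μ` — the right shape for the all-`U` lane, but too strong for the realistic supplier of the VOLUME direction: the engine's
export holds only in the KL regime (`c ≤ c₅`, `μ ∈ klWindowC`, `0 < U ≤ U₀(c)`, `klBetaMin ≤ β ≤ e^{c/U²}`).  This file restates the doors
with the inputs quantified by EXACTLY the stub's own prefix (`∃ c₅ > 0, ∀ c ≤ c₅, ∃ U₀ > 0, ∀ μ ∈ klWindowC, ∀ U ≤ U₀, ∀ β ∈ [klBetaMin,
e^{c/U²}]`, bare-frame data at `(β, U, μ)`), frame-free and tower-free:

* `stub_vl_twoVolumeRate_of_bareFrameRate_regime` / `…_regime_V14` — bare bound + bare two-volume rate in the regime ⇒ the stub text;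
* `stub_vl_twoVolumeRate_of_bareSplit_regime` / `…_regime_V14` — bare bound + label-uniform cutoff limit towards proxies + two-volume
  rate of the proxies, in the regime ⇒ the stub text.

Pure quantifier threading over `twoVolumeRate_frame_transfer_of_bare` / `twoVolumeRate_bare_of_split`; nothing is asserted about the model.
-/

noncomputable section

namespace Summit.HubbardSuperconductivity.HubbardSuperconductivity.Theorems.KLRegimeSplit

set_option linter.dupNamespace false -- summit = problem name (single-conjunct summit), D-0017

open Filter Topology Finset Real Literature.MathematicalPhysics.QuantumLattice Literature.Probability.LatticeModels
open Literature.MathematicalPhysics.QuantumLattice.FermiRG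
open Summit.HubbardSuperconductivity.HubbardSuperconductivity.Theorems.KLProgrammeLegKernels
open Summit.HubbardSuperconductivity.HubbardSuperconductivity.Theorems.TwoPointAssembly

/-- **REGIME DOOR (V12, stmt-19858)**: bare bound + bare two-volume rate, asked only in the KL regime, ⇒ the registered stub text. -/
theorem stub_vl_twoVolumeRate_of_bareFrameRate_regime
    (hreg : ∃ c₅ : ℝ, 0 < c₅ ∧ ∀ c : ℝ, 0 < c → c ≤ c₅ → ∃ U₀ : ℝ, 0 < U₀ ∧
      ∀ μ ∈ klWindowC, ∀ U : ℝ, 0 < U → U ≤ U₀ → ∀ β : ℝ, klBetaMin ≤ β → β ≤ Real.exp (c / U ^ 2) →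
          ∃ B₀ : ℝ, ∃ L₀ : ℕ, ∃ Mth : ℕ → ℕ, ∃ D : ℝ, ∃ ρ : ℕ → ℝ, Tendsto ρ atTop (𝓝 0) ∧
            (∀ (L : ℕ) [NeZero L], L₀ ≤ L → ∀ (M : ℕ) [NeZero M], Mth L ≤ M →
              ∀ (k : FreqMomentum L M) (σ : Fin 2), ‖klSelfEnergy L M β U μ 0 klE0 (nScales β + 1) k σ‖ ≤ B₀) ∧
            (∀ (L : ℕ) [NeZero L], L₀ ≤ L → ∀ (M : ℕ) [NeZero M], Mth L ≤ M →
              ∀ (L' : ℕ) [NeZero L'], L ≤ L' → ∀ (M' : ℕ) [NeZero M'], Mth L' ≤ M' →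
                ∀ (σ : Fin 2) (ω : MatsubaraIdx M) (ω' : MatsubaraIdx M'), matsubaraInt M ω = matsubaraInt M' ω' →
                  ∀ (k : TorusSite 2 L) (k' : TorusSite 2 L'),
                    ‖klSelfEnergy L M β U μ 0 klE0 (nScales β + 1) (ω, k) σ -
                        klSelfEnergy L' M' β U μ 0 klE0 (nScales β + 1) (ω', k') σ‖ ≤
                      ρ L + D * ∑ i, torusAbs (latticeMomentum L k i - latticeMomentum L' k' i))) :
    ∀ (G : GeoConsts) (P : SplitConsts) (Q : EngConsts) (R : RenConsts), G.WF → P.WF → Q.WF → R.WF →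
      ∃ c₅ : ℝ, 0 < c₅ ∧ ∀ c : ℝ, 0 < c → c ≤ c₅ → ∃ U₀ : ℝ, 0 < U₀ ∧
        ∀ μ ∈ klWindowC, ∀ U : ℝ, 0 < U → U ≤ U₀ → ∀ β : ℝ, klBetaMin ≤ β → β ≤ Real.exp (c / U ^ 2) →
          ∀ K : TrigPolyC4v, klPredsV12.frameOK R U (nScales β) μ K →
            ∀ (Lstar : ℕ) (Mstar : ℕ → ℕ), TowerP klPredsV12 G P Q R β U μ K Lstar Mstar →
              ∃ L₀ : ℕ, ∃ Mth : ℕ → ℕ, ∃ D : ℝ, ∃ ρ : ℕ → ℝ, Tendsto ρ atTop (𝓝 0) ∧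
                ∀ (L : ℕ) [NeZero L], L₀ ≤ L → ∀ (M : ℕ) [NeZero M], Mth L ≤ M →
                  ∀ (L' : ℕ) [NeZero L'], L ≤ L' → ∀ (M' : ℕ) [NeZero M'], Mth L' ≤ M' →
                    ∀ (σ : Fin 2) (ω : MatsubaraIdx M) (ω' : MatsubaraIdx M'), matsubaraInt M ω = matsubaraInt M' ω' →
                      ∀ (k : TorusSite 2 L) (k' : TorusSite 2 L'),
                        ‖klSelfEnergy L M β U μ K klE0 (nScales β + 1) (ω, k) σ -
                            klSelfEnergy L' M' β U μ K klE0 (nScales β + 1) (ω', k') σ‖ ≤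
                          ρ L + D * ∑ i, torusAbs (latticeMomentum L k i - latticeMomentum L' k' i) := by
  intro G P Q R _ _ _ _
  obtain ⟨c₅, hc₅, h⟩ := hreg
  refine ⟨c₅, hc₅, fun c hc hcle => ?_⟩
  obtain ⟨U₀, hU₀, h'⟩ := h c hc hcle
  refine ⟨U₀, hU₀, ?_⟩
  intro μ hμ U hU hUle β hβmin hβle K hK Lstar Mstar _
  have hβ : 0 < β := pos_of_klBetaMin_le hβmin
  obtain ⟨B₀, L₀, Mth, D, ρ, hρ, hb, hr⟩ := h' μ hμ U hU hUle β hβmin hβle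
  exact twoVolumeRate_frame_transfer_of_bare hβ U μ hK hb ⟨D, ρ, hρ, hr⟩

/-- **REGIME DOOR (V14, gen-5 re-base)**: bare bound + bare two-volume rate, asked only in the KL regime, ⇒ the registered stub text. -/
theorem stub_vl_twoVolumeRate_of_bareFrameRate_regime_V14
    (hreg : ∃ c₅ : ℝ, 0 < c₅ ∧ ∀ c : ℝ, 0 < c → c ≤ c₅ → ∃ U₀ : ℝ, 0 < U₀ ∧
      ∀ μ ∈ klWindowC, ∀ U : ℝ, 0 < U → U ≤ U₀ → ∀ β : ℝ, klBetaMin ≤ β → β ≤ Real.exp (c / U ^ 2) →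
          ∃ B₀ : ℝ, ∃ L₀ : ℕ, ∃ Mth : ℕ → ℕ, ∃ D : ℝ, ∃ ρ : ℕ → ℝ, Tendsto ρ atTop (𝓝 0) ∧
            (∀ (L : ℕ) [NeZero L], L₀ ≤ L → ∀ (M : ℕ) [NeZero M], Mth L ≤ M →
              ∀ (k : FreqMomentum L M) (σ : Fin 2), ‖klSelfEnergy L M β U μ 0 klE0 (nScales β + 1) k σ‖ ≤ B₀) ∧
            (∀ (L : ℕ) [NeZero L], L₀ ≤ L → ∀ (M : ℕ) [NeZero M], Mth L ≤ M →
              ∀ (L' : ℕ) [NeZero L'], L ≤ L' → ∀ (M' : ℕ) [NeZero M'], Mth L' ≤ M' →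
                ∀ (σ : Fin 2) (ω : MatsubaraIdx M) (ω' : MatsubaraIdx M'), matsubaraInt M ω = matsubaraInt M' ω' →
                  ∀ (k : TorusSite 2 L) (k' : TorusSite 2 L'),
                    ‖klSelfEnergy L M β U μ 0 klE0 (nScales β + 1) (ω, k) σ -
                        klSelfEnergy L' M' β U μ 0 klE0 (nScales β + 1) (ω', k') σ‖ ≤
                      ρ L + D * ∑ i, torusAbs (latticeMomentum L k i - latticeMomentum L' k' i))) :
    ∀ (G : GeoConsts) (P : SplitConsts) (Q : EngConsts) (R : RenConsts), G.WF → P.WF → Q.WF → R.WF →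
      ∃ c₅ : ℝ, 0 < c₅ ∧ ∀ c : ℝ, 0 < c → c ≤ c₅ → ∃ U₀ : ℝ, 0 < U₀ ∧
        ∀ μ ∈ klWindowC, ∀ U : ℝ, 0 < U → U ≤ U₀ → ∀ β : ℝ, klBetaMin ≤ β → β ≤ Real.exp (c / U ^ 2) →
          ∀ K : TrigPolyC4v, klPredsV14.frameOK R U (nScales β) μ K →
            ∀ (Lstar : ℕ) (Mstar : ℕ → ℕ), TowerP klPredsV14 G P Q R β U μ K Lstar Mstar →
              ∃ L₀ : ℕ, ∃ Mth : ℕ → ℕ, ∃ D : ℝ, ∃ ρ : ℕ → ℝ, Tendsto ρ atTop (𝓝 0) ∧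
                ∀ (L : ℕ) [NeZero L], L₀ ≤ L → ∀ (M : ℕ) [NeZero M], Mth L ≤ M →
                  ∀ (L' : ℕ) [NeZero L'], L ≤ L' → ∀ (M' : ℕ) [NeZero M'], Mth L' ≤ M' →
                    ∀ (σ : Fin 2) (ω : MatsubaraIdx M) (ω' : MatsubaraIdx M'), matsubaraInt M ω = matsubaraInt M' ω' →
                      ∀ (k : TorusSite 2 L) (k' : TorusSite 2 L'),
                        ‖klSelfEnergy L M β U μ K klE0 (nScales β + 1) (ω, k) σ -
                            klSelfEnergy L' M' β U μ K klE0 (nScales β + 1) (ω', k') σ‖ ≤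
                          ρ L + D * ∑ i, torusAbs (latticeMomentum L k i - latticeMomentum L' k' i) := by
  intro G P Q R _ _ _ _
  obtain ⟨c₅, hc₅, h⟩ := hreg
  refine ⟨c₅, hc₅, fun c hc hcle => ?_⟩
  obtain ⟨U₀, hU₀, h'⟩ := h c hc hcle
  refine ⟨U₀, hU₀, ?_⟩
  intro μ hμ U hU hUle β hβmin hβle K hK Lstar Mstar _
  have hβ : 0 < β := pos_of_klBetaMin_le hβmin
  obtain ⟨B₀, L₀, Mth, D, ρ, hρ, hb, hr⟩ := h' μ hμ U hU hUle β hβmin hβle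
  exact twoVolumeRate_frame_transfer_of_bare hβ U μ hK hb ⟨D, ρ, hρ, hr⟩

/-- **REGIME THREE-INPUT DOOR (V12, stmt-19858)**: bare bound + label-uniform cutoff limit + two-volume rate of the proxies, in the regime, ⇒ the stub text. -/
theorem stub_vl_twoVolumeRate_of_bareSplit_regime
    (hreg : ∃ c₅ : ℝ, 0 < c₅ ∧ ∀ c : ℝ, 0 < c → c ≤ c₅ → ∃ U₀ : ℝ, 0 < U₀ ∧
      ∀ μ ∈ klWindowC, ∀ U : ℝ, 0 < U → U ≤ U₀ → ∀ β : ℝ, klBetaMin ≤ β → β ≤ Real.exp (c / U ^ 2) →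
          ∃ B₀ : ℝ, ∃ L₀ : ℕ, ∃ Mth : ℕ → ℕ,
            ∃ Sinf : ∀ (L : ℕ) [NeZero L], ℤ → TorusSite 2 L → Fin 2 → ℂ, ∃ D : ℝ, ∃ ρ : ℕ → ℝ, Tendsto ρ atTop (𝓝 0) ∧
            (∀ (L : ℕ) [NeZero L], L₀ ≤ L → ∀ (M : ℕ) [NeZero M], Mth L ≤ M →
              ∀ (k : FreqMomentum L M) (σ : Fin 2), ‖klSelfEnergy L M β U μ 0 klE0 (nScales β + 1) k σ‖ ≤ B₀) ∧
            (∀ (L : ℕ) [NeZero L], L₀ ≤ L → ∀ ε : ℝ, 0 < ε → ∃ M₁ : ℕ, ∀ (M : ℕ) [NeZero M], M₁ ≤ M →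
              ∀ (ω : MatsubaraIdx M) (k : TorusSite 2 L) (σ : Fin 2),
                ‖klSelfEnergy L M β U μ 0 klE0 (nScales β + 1) (ω, k) σ - Sinf L (matsubaraInt M ω) k σ‖ ≤ ε) ∧
            (∀ (L : ℕ) [NeZero L], L₀ ≤ L → ∀ (L' : ℕ) [NeZero L'], L ≤ L' →
              ∀ (n : ℤ) (σ : Fin 2) (k : TorusSite 2 L) (k' : TorusSite 2 L'),
                ‖Sinf L n k σ - Sinf L' n k' σ‖ ≤ ρ L + D * ∑ i, torusAbs (latticeMomentum L k i - latticeMomentum L' k' i))) :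
    ∀ (G : GeoConsts) (P : SplitConsts) (Q : EngConsts) (R : RenConsts), G.WF → P.WF → Q.WF → R.WF →
      ∃ c₅ : ℝ, 0 < c₅ ∧ ∀ c : ℝ, 0 < c → c ≤ c₅ → ∃ U₀ : ℝ, 0 < U₀ ∧
        ∀ μ ∈ klWindowC, ∀ U : ℝ, 0 < U → U ≤ U₀ → ∀ β : ℝ, klBetaMin ≤ β → β ≤ Real.exp (c / U ^ 2) →
          ∀ K : TrigPolyC4v, klPredsV12.frameOK R U (nScales β) μ K →
            ∀ (Lstar : ℕ) (Mstar : ℕ → ℕ), TowerP klPredsV12 G P Q R β U μ K Lstar Mstar →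
              ∃ L₀ : ℕ, ∃ Mth : ℕ → ℕ, ∃ D : ℝ, ∃ ρ : ℕ → ℝ, Tendsto ρ atTop (𝓝 0) ∧
                ∀ (L : ℕ) [NeZero L], L₀ ≤ L → ∀ (M : ℕ) [NeZero M], Mth L ≤ M →
                  ∀ (L' : ℕ) [NeZero L'], L ≤ L' → ∀ (M' : ℕ) [NeZero M'], Mth L' ≤ M' →
                    ∀ (σ : Fin 2) (ω : MatsubaraIdx M) (ω' : MatsubaraIdx M'), matsubaraInt M ω = matsubaraInt M' ω' →
                      ∀ (k : TorusSite 2 L) (k' : TorusSite 2 L'),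
                        ‖klSelfEnergy L M β U μ K klE0 (nScales β + 1) (ω, k) σ -
                            klSelfEnergy L' M' β U μ K klE0 (nScales β + 1) (ω', k') σ‖ ≤
                          ρ L + D * ∑ i, torusAbs (latticeMomentum L k i - latticeMomentum L' k' i) := by
  intro G P Q R _ _ _ _
  obtain ⟨c₅, hc₅, h⟩ := hreg
  refine ⟨c₅, hc₅, fun c hc hcle => ?_⟩
  obtain ⟨U₀, hU₀, h'⟩ := h c hc hcle
  refine ⟨U₀, hU₀, ?_⟩
  intro μ hμ U hU hUle β hβmin hβle K hK Lstar Mstar _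
  have hβ : 0 < β := pos_of_klBetaMin_le hβmin
  obtain ⟨B₀, L₀, Mth, Sinf, D, ρ, hρ, hb, hcut, hvol⟩ := h' μ hμ U hU hUle β hβmin hβle
  obtain ⟨Mth', D', ρ', hρ', hb', hr'⟩ := twoVolumeRate_bare_of_split hρ hb hcut hvol
  exact twoVolumeRate_frame_transfer_of_bare hβ U μ hK hb' ⟨D', ρ', hρ', hr'⟩

/-- **REGIME THREE-INPUT DOOR (V14, gen-5 re-base)**: bare bound + label-uniform cutoff limit + two-volume rate of the proxies, in the regime, ⇒ the stub text. -/
theorem stub_vl_twoVolumeRate_of_bareSplit_regime_V14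
    (hreg : ∃ c₅ : ℝ, 0 < c₅ ∧ ∀ c : ℝ, 0 < c → c ≤ c₅ → ∃ U₀ : ℝ, 0 < U₀ ∧
      ∀ μ ∈ klWindowC, ∀ U : ℝ, 0 < U → U ≤ U₀ → ∀ β : ℝ, klBetaMin ≤ β → β ≤ Real.exp (c / U ^ 2) →
          ∃ B₀ : ℝ, ∃ L₀ : ℕ, ∃ Mth : ℕ → ℕ,
            ∃ Sinf : ∀ (L : ℕ) [NeZero L], ℤ → TorusSite 2 L → Fin 2 → ℂ, ∃ D : ℝ, ∃ ρ : ℕ → ℝ, Tendsto ρ atTop (𝓝 0) ∧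
            (∀ (L : ℕ) [NeZero L], L₀ ≤ L → ∀ (M : ℕ) [NeZero M], Mth L ≤ M →
              ∀ (k : FreqMomentum L M) (σ : Fin 2), ‖klSelfEnergy L M β U μ 0 klE0 (nScales β + 1) k σ‖ ≤ B₀) ∧
            (∀ (L : ℕ) [NeZero L], L₀ ≤ L → ∀ ε : ℝ, 0 < ε → ∃ M₁ : ℕ, ∀ (M : ℕ) [NeZero M], M₁ ≤ M →
              ∀ (ω : MatsubaraIdx M) (k : TorusSite 2 L) (σ : Fin 2),
                ‖klSelfEnergy L M β U μ 0 klE0 (nScales β + 1) (ω, k) σ - Sinf L (matsubaraInt M ω) k σ‖ ≤ ε) ∧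
            (∀ (L : ℕ) [NeZero L], L₀ ≤ L → ∀ (L' : ℕ) [NeZero L'], L ≤ L' →
              ∀ (n : ℤ) (σ : Fin 2) (k : TorusSite 2 L) (k' : TorusSite 2 L'),
                ‖Sinf L n k σ - Sinf L' n k' σ‖ ≤ ρ L + D * ∑ i, torusAbs (latticeMomentum L k i - latticeMomentum L' k' i))) :
    ∀ (G : GeoConsts) (P : SplitConsts) (Q : EngConsts) (R : RenConsts), G.WF → P.WF → Q.WF → R.WF →
      ∃ c₅ : ℝ, 0 < c₅ ∧ ∀ c : ℝ, 0 < c → c ≤ c₅ → ∃ U₀ : ℝ, 0 < U₀ ∧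
        ∀ μ ∈ klWindowC, ∀ U : ℝ, 0 < U → U ≤ U₀ → ∀ β : ℝ, klBetaMin ≤ β → β ≤ Real.exp (c / U ^ 2) →
          ∀ K : TrigPolyC4v, klPredsV14.frameOK R U (nScales β) μ K →
            ∀ (Lstar : ℕ) (Mstar : ℕ → ℕ), TowerP klPredsV14 G P Q R β U μ K Lstar Mstar →
              ∃ L₀ : ℕ, ∃ Mth : ℕ → ℕ, ∃ D : ℝ, ∃ ρ : ℕ → ℝ, Tendsto ρ atTop (𝓝 0) ∧
                ∀ (L : ℕ) [NeZero L], L₀ ≤ L → ∀ (M : ℕ) [NeZero M], Mth L ≤ M →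
                  ∀ (L' : ℕ) [NeZero L'], L ≤ L' → ∀ (M' : ℕ) [NeZero M'], Mth L' ≤ M' →
                    ∀ (σ : Fin 2) (ω : MatsubaraIdx M) (ω' : MatsubaraIdx M'), matsubaraInt M ω = matsubaraInt M' ω' →
                      ∀ (k : TorusSite 2 L) (k' : TorusSite 2 L'),
                        ‖klSelfEnergy L M β U μ K klE0 (nScales β + 1) (ω, k) σ -
                            klSelfEnergy L' M' β U μ K klE0 (nScales β + 1) (ω', k') σ‖ ≤
                          ρ L + D * ∑ i, torusAbs (latticeMomentum L k i - latticeMomentum L' k' i) := by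
  intro G P Q R _ _ _ _
  obtain ⟨c₅, hc₅, h⟩ := hreg
  refine ⟨c₅, hc₅, fun c hc hcle => ?_⟩
  obtain ⟨U₀, hU₀, h'⟩ := h c hc hcle
  refine ⟨U₀, hU₀, ?_⟩
  intro μ hμ U hU hUle β hβmin hβle K hK Lstar Mstar _
  have hβ : 0 < β := pos_of_klBetaMin_le hβmin
  obtain ⟨B₀, L₀, Mth, Sinf, D, ρ, hρ, hb, hcut, hvol⟩ := h' μ hμ U hU hUle β hβmin hβle
  obtain ⟨Mth', D', ρ', hρ', hb', hr'⟩ := twoVolumeRate_bare_of_split hρ hb hcut hvol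
  exact twoVolumeRate_frame_transfer_of_bare hβ U μ hK hb' ⟨D', ρ', hρ', hr'⟩

end Summit.HubbardSuperconductivity.HubbardSuperconductivity.Theorems.KLRegimeSplit

end
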